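import Literature.NumberTheory.Automorphic.ConstantTermUnitElement
import Literature.MeasureTheory.Group.SubgroupRelIndexMeasure
import Mathlib.SetTheory.Cardinal.NatCard
import HarnessLib

/-!
# The `K`-averaged constant term of the IWAHORI unit at a torus element: `∫_{K×N} 1_I(k (t n) k⁻¹) = 2 · κ(I) · μ_N(N ∩ K) · 1_K(t)`
(Kottwitz (1988) §2: the Euler–Poincaré function on a rank-one Bruhat–Tits tree has vanishing hyperbolic orbital integrals — «per
translation period of the split torus on its fixed tube, vertices − edges = 0»; the EDGE term is this Iwahori average; Rogawski (1990)
§4.9 (4.9.2) `Φ(γ, f) = |D(γ)|^{-1∕2} f^{(B)}(γ)`; Cartier (1979) §IV (4.2) for the constant term along `P = T N`)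

Topic `NumberTheory/Automorphic`; namespace `Literature.NumberTheory.Automorphic`.  KERNEL mathematics only: theorems, no definition, no
named fact, no instance, no notation, no `sorry`.  GENERIC group layer, sequel of ★ `ConstantTermUnitElement` (A-p06: the same average for
the hyperspecial unit `1_K`, value `κ(K) · μ_N(N ∩ K) · 1_K(t)`).  Cell `pub/hodgecm-mathlib`, crux H413 = `stmt-HodgeConjecture-24833`, line
«N6nsGerm», stub `stub_N6nsR2EP : RankOneEulerPoincareNonsplit` ((R2), Kottwitz's Euler–Poincaré function on `U(Φ₂)_v`), brick (ii)
«the Iwahori unit at a split-torus regular class» (EP pen B-p04 (g34), census `B-provers/B-p04/g34/CENSUS-R2EP-RankOneEulerPoincare.B-p04g34.md`;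
B-p10 (g25) «=» 08:29Z; seat F0P3a-p04 (g13)).  HONEST LABEL: HC_CM is proved only modulo the printed citations until rung 0 closes; nothing
printed is asserted here.

THE MATHEMATICS.  `G` a group, `K ≥ I` subgroups (a maximal compact and its Iwahori), `T`, `N` (a torus normalising an ABELIAN unipotent
group), `w ∈ K` (a Weyl representative), in «rank-one Iwahori position»:
(gp) `t n ∈ K ⇒ t ∈ K` for `t ∈ T`, `n ∈ N`;  (bo) `T ∩ K ⊆ I`, `N ∩ K ⊆ I`, `w (T ∩ K) w⁻¹ ⊆ I`;  (br) BRUHAT `K = I ⊔ I·w·(N ∩ K)`, i.e. every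
`k ∈ K ∖ I` is `i w x` with `i ∈ I`, `x ∈ N ∩ K`, and `w x ∉ I` for `x ∈ N ∩ K`.  Put `N_𝔭 := {m ∈ N | w m w⁻¹ ∈ I}` (the «deeper» unipotents;
`N_𝔭 ≤ N ∩ K`).  Then for `t ∈ T ∩ K` and `k ∈ K` the fibre `{n ∈ N | k (t n) k⁻¹ ∈ I}` is `N ∩ K` if `k ∈ I` (§1), and a TRANSLATE of `N_𝔭` if
`k = i w x ∉ I` (§1: `w (x t n x⁻¹) w⁻¹ = (w t w⁻¹)·(w m w⁻¹)`, `m = n · (t⁻¹ x t) x⁻¹`); the left cosets `K ∕ I` are `{I} ⊔ {x w⁻¹ I : x ∈ (N ∩ K) ∕ N_𝔭}`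
(§2: `[K : I] = [N ∩ K : N_𝔭] + 1`), so `κ(K ∖ I) = [N ∩ K : N_𝔭] · κ(I)` and Tonelli gives (§3)
**`∫⁻_{K × N} 1_I(k (t n) k⁻¹) d(κ ⊗ μ_N) = κ(I)·μ_N(N ∩ K) + κ(K ∖ I)·μ_N(N_𝔭) = 2 · κ(I) · μ_N(N ∩ K)`** (and `0` for `t ∈ T ∖ K`) — uniformly in
`t`, with NO regularity and NO residue-field arithmetic (the depth of `t` never enters).  Divided by the hyperspecial value this is the «2» of
`(E − 2V = 0)` per period.  NOT here: the Iwasawa unfolding (★ `KNAQuotientIntegration`, ★ `TorusOrbitalDescentTwist`), the instance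
`G = U(Φ₂)(L⁺_v)` (sequel `UnitaryIwahoriOrbitalIntegralSplitTorus`).

## References
* [Kottwitz1988] R. E. Kottwitz, *Tamagawa numbers*, Ann. of Math. 127 (1988), §2 (orbital integrals of Euler–Poincaré functions).
* [Rogawski1990] J. D. Rogawski, *Automorphic Representations of Unitary Groups in Three Variables*, Ann. of Math. Stud. 123 (1990), §4.9
  (4.9.2) p. 55; §4.13, proof of Lemma 4.13.1, p. 70; §12.6 p. 174.
* [CartierCorvallis1979] P. Cartier, *Representations of 𝔭-adic groups: a survey*, PSPM 33.1 (1979), §IV (4.2); §III.5 (Iwahori decomposition).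
* [Serre1980Trees] J.-P. Serre, *Trees* (1980), II §1.1 (the tree of `SL₂` over a local field).
-/

set_option autoImplicit false

noncomputable section

open MeasureTheory Measure Set
open scoped ENNReal

namespace Literature.NumberTheory.Automorphic

/-! ## §1 The two fibres `{n ∈ N | k (t n) k⁻¹ ∈ I}` -/

section Fibres

variable {G : Type*} [Group G] {K I T N : Subgroup G}

/-- For `k ∈ I` and `t ∈ I`: `k (t n) k⁻¹ ∈ I ↔ n ∈ K` (`n ∈ N`), when `N ∩ K ⊆ I ≤ K`. [cite: CartierCorvallis1979, §IV (4.2)] -/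
theorem setOf_conj_mul_coe_mem_iwahori_eq_of_mem (hIK : I ≤ K) (hNI : ∀ n ∈ N, n ∈ K → n ∈ I)
    {k : G} (hk : k ∈ I) {t : G} (htI : t ∈ I) :
    {n : ↥N | k * (t * (n : G)) * k⁻¹ ∈ I} = {n : ↥N | (n : G) ∈ K} := by
  ext n
  rw [mem_setOf_eq, mem_setOf_eq, Subgroup.mul_mem_cancel_right I (inv_mem hk), Subgroup.mul_mem_cancel_left I hk,
    Subgroup.mul_mem_cancel_left I htI]
  exact ⟨fun h => hIK h, fun h => hNI _ n.2 h⟩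

/-- For `k = i w x` off the Iwahori (`i ∈ I`, `x ∈ N`) and `t ∈ T` with `w t w⁻¹ ∈ I`: `k (t n) k⁻¹ ∈ I ↔ w (n c) w⁻¹ ∈ I` with the constant
`c = (t⁻¹ x t) x⁻¹ ∈ N` (`T` normalises the abelian `N`), i.e. the fibre is the `c`-translate of `N_𝔭 = {m ∈ N | w m w⁻¹ ∈ I}`.
[cite: Kottwitz1988, §2] [cite: CartierCorvallis1979, §III.5] -/
theorem setOf_conj_mul_coe_mem_iwahori_eq_preimage_of_eq (hTN : ∀ t ∈ T, ∀ n ∈ N, t⁻¹ * n * t ∈ N)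
    (hNc : ∀ a ∈ N, ∀ b ∈ N, a * b = b * a) {w i x t : G} (hi : i ∈ I) (hx : x ∈ N) (ht : t ∈ T) (hwt : w * t * w⁻¹ ∈ I) :
    {n : ↥N | i * w * x * (t * (n : G)) * (i * w * x)⁻¹ ∈ I} =
      (fun n : ↥N => (⟨t⁻¹ * x * t * x⁻¹, mul_mem (hTN t ht x hx) (inv_mem hx)⟩ : ↥N) * n) ⁻¹'
        ((I.comap ((MulAut.conj w).toMonoidHom.comp N.subtype) : Subgroup ↥N) : Set ↥N) := by
  ext n
  have hc : t⁻¹ * x * t * x⁻¹ ∈ N := mul_mem (hTN t ht x hx) (inv_mem hx)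
  rw [mem_setOf_eq, mem_preimage, SetLike.mem_coe, Subgroup.mem_comap, MonoidHom.coe_comp, Function.comp_apply,
    Subgroup.coe_subtype, MulEquiv.coe_toMonoidHom, MulAut.conj_apply, Subgroup.coe_mul]
  -- `k (t n) k⁻¹ = i · [w (x t n x⁻¹) w⁻¹] · i⁻¹` and `x t n x⁻¹ = t · ((t⁻¹ x t) n x⁻¹) = t · (c n)`
  have h1 : i * w * x * (t * (n : G)) * (i * w * x)⁻¹ = i * (w * (t * ((t⁻¹ * x * t * x⁻¹) * (n : G))) * w⁻¹) * i⁻¹ := by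
    have hcomm : x⁻¹ * (n : G) = (n : G) * x⁻¹ := hNc _ (inv_mem hx) _ n.2
    calc i * w * x * (t * (n : G)) * (i * w * x)⁻¹
        = i * (w * (x * t * (n : G) * x⁻¹) * w⁻¹) * i⁻¹ := by group
      _ = i * (w * (t * (t⁻¹ * x * t) * ((n : G) * x⁻¹)) * w⁻¹) * i⁻¹ := by group
      _ = i * (w * (t * (t⁻¹ * x * t) * (x⁻¹ * (n : G))) * w⁻¹) * i⁻¹ := by rw [hcomm]
      _ = i * (w * (t * ((t⁻¹ * x * t * x⁻¹) * (n : G))) * w⁻¹) * i⁻¹ := by group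
  rw [h1, Subgroup.mul_mem_cancel_right I (inv_mem hi), Subgroup.mul_mem_cancel_left I hi]
  have h2 : w * (t * ((t⁻¹ * x * t * x⁻¹) * (n : G))) * w⁻¹ = (w * t * w⁻¹) * (w * ((t⁻¹ * x * t * x⁻¹) * (n : G)) * w⁻¹) := by group
  rw [h2, Subgroup.mul_mem_cancel_left I hwt]

/-- If `t ∈ T ∖ K` (good position), NO conjugate `k (t n) k⁻¹`, `k ∈ K`, `n ∈ N`, lies in `I ≤ K`. [cite: CartierCorvallis1979, §IV (4.2)] -/
theorem conj_mul_notMem_iwahori_of_notMem (hIK : I ≤ K) (hKP : ∀ ⦃t n : G⦄, t ∈ T → n ∈ N → t * n ∈ K → t ∈ K)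
    {k t n : G} (hk : k ∈ K) (ht : t ∈ T) (hn : n ∈ N) (htK : t ∉ K) : k * (t * n) * k⁻¹ ∉ I := fun h =>
  htK (hKP ht hn ((Subgroup.mul_mem_cancel_left K hk).1 ((Subgroup.mul_mem_cancel_right K (inv_mem hk)).1 (hIK h))))

end Fibres

/-! ## §2 The Bruhat count `[K : I] = [N ∩ K : N_𝔭] + 1` -/

section Index

variable {G : Type*} [Group G] {K I N : Subgroup G}

/-- **`K ∕ I ≃ {I} ⊔ (N ∩ K) ∕ N_𝔭`**, `x ↦ x w⁻¹ I`: from the rank-one Bruhat decomposition `K = I ⊔ I w (N ∩ K)` (every `k ∈ K ∖ I` is `i w x`,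
and `w x ∉ I`), with `N_𝔭 = {m ∈ N | w m w⁻¹ ∈ I}`. [cite: CartierCorvallis1979, §III.5] [cite: Serre1980Trees, II §1.1] -/
theorem exists_equiv_option_quotient_iwahori {w : G} (hw : w ∈ K)
    (hBr : ∀ k ∈ K, k ∉ I → ∃ i ∈ I, ∃ x ∈ N, x ∈ K ∧ k = i * w * x) (hdisj : ∀ x ∈ N, x ∈ K → w * x ∉ I) :
    Nonempty (Option (↥(K.subgroupOf N) ⧸ (I.comap ((MulAut.conj w).toMonoidHom.comp N.subtype)).subgroupOf (K.subgroupOf N)) ≃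
      (↥K ⧸ I.subgroupOf K)) := by
  classical
  -- the map `x ↦ (x w⁻¹) I` on `N ∩ K`
  let f₀ : ↥(K.subgroupOf N) → ↥K ⧸ I.subgroupOf K := fun x =>
    QuotientGroup.mk ⟨((x : ↥N) : G) * w⁻¹, mul_mem (Subgroup.mem_subgroupOf.1 x.2) (inv_mem hw)⟩
  have hxw : ∀ x : ↥(K.subgroupOf N), ((x : ↥N) : G) * w⁻¹ ∈ K := fun x =>
    mul_mem (Subgroup.mem_subgroupOf.1 x.2) (inv_mem hw)
  have hmemP' : ∀ z : ↥(K.subgroupOf N),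
      z ∈ (I.comap ((MulAut.conj w).toMonoidHom.comp N.subtype)).subgroupOf (K.subgroupOf N) ↔ w * ((z : ↥N) : G) * w⁻¹ ∈ I := fun z => by
    rw [Subgroup.mem_subgroupOf, Subgroup.mem_comap, MonoidHom.coe_comp, Function.comp_apply, Subgroup.coe_subtype,
      MulEquiv.coe_toMonoidHom, MulAut.conj_apply]
  have hrel : ∀ x y : ↥(K.subgroupOf N), f₀ x = f₀ y ↔
      x⁻¹ * y ∈ (I.comap ((MulAut.conj w).toMonoidHom.comp N.subtype)).subgroupOf (K.subgroupOf N) := by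
    intro x y
    have hcoe : (((⟨((x : ↥N) : G) * w⁻¹, hxw x⟩ : ↥K)⁻¹ * ⟨((y : ↥N) : G) * w⁻¹, hxw y⟩ : ↥K) : G) =
        w * (((x⁻¹ * y : ↥(K.subgroupOf N)) : ↥N) : G) * w⁻¹ := by
      simp only [Subgroup.coe_mul, Subgroup.coe_inv]
      group
    refine QuotientGroup.eq.trans ?_
    rw [hmemP']
    change (((⟨((x : ↥N) : G) * w⁻¹, hxw x⟩ : ↥K)⁻¹ * ⟨((y : ↥N) : G) * w⁻¹, hxw y⟩ : ↥K) : G) ∈ I ↔ _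
    rw [hcoe]
  let f : ↥(K.subgroupOf N) ⧸ (I.comap ((MulAut.conj w).toMonoidHom.comp N.subtype)).subgroupOf (K.subgroupOf N) → ↥K ⧸ I.subgroupOf K :=
    Quotient.lift f₀ fun x y hxy => (hrel x y).2 (QuotientGroup.leftRel_apply.1 hxy)
  have hf : ∀ x, f (QuotientGroup.mk x) = f₀ x := fun _ => rfl
  refine ⟨Equiv.ofBijective (fun o => o.elim (QuotientGroup.mk 1) f) ⟨?_, ?_⟩⟩
  · -- injective
    have hne : ∀ x : ↥(K.subgroupOf N), f₀ x ≠ QuotientGroup.mk 1 := by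
      intro x h
      have h1 : (⟨((x : ↥N) : G) * w⁻¹, hxw x⟩ : ↥K)⁻¹ * 1 ∈ I.subgroupOf K := QuotientGroup.eq.1 h
      rw [mul_one, Subgroup.mem_subgroupOf, Subgroup.coe_inv] at h1
      have h2 : (((x : ↥N) : G) * w⁻¹)⁻¹ = w * (((x⁻¹ : ↥(K.subgroupOf N)) : ↥N) : G) := by
        simp only [Subgroup.coe_inv, mul_inv_rev, inv_inv]
      rw [show ((⟨((x : ↥N) : G) * w⁻¹, hxw x⟩ : ↥K) : G) = ((x : ↥N) : G) * w⁻¹ from rfl, h2] at h1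
      exact hdisj _ ((x⁻¹ : ↥(K.subgroupOf N)) : ↥N).2 (Subgroup.mem_subgroupOf.1 (x⁻¹).2) h1
    rintro (_ | a) (_ | b) hab
    · rfl
    · exact absurd hab.symm (by induction b using QuotientGroup.induction_on with | H x => exact hne x)
    · exact absurd hab (by induction a using QuotientGroup.induction_on with | H x => exact hne x)
    · induction a using QuotientGroup.induction_on with | H x =>
      induction b using QuotientGroup.induction_on with | H y =>
      exact congrArg some (Quotient.sound (QuotientGroup.leftRel_apply.2 ((hrel x y).1 hab)))
  · -- surjective
    intro q
    induction q using QuotientGroup.induction_on with | H k =>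
    by_cases hk : (k : G) ∈ I
    · refine ⟨none, ?_⟩
      change QuotientGroup.mk 1 = QuotientGroup.mk k
      rw [QuotientGroup.eq, Subgroup.mem_subgroupOf, Subgroup.coe_mul, Subgroup.coe_inv, Subgroup.coe_one, inv_one, one_mul]
      exact hk
    · obtain ⟨i, hi, x, hxN, hxK, hkx⟩ := hBr _ (inv_mem k.2) (fun h => hk (by simpa using inv_mem h))
      refine ⟨some (QuotientGroup.mk ⟨⟨x, hxN⟩⁻¹, Subgroup.mem_subgroupOf.2 (by
        rw [Subgroup.coe_inv]; exact inv_mem hxK)⟩), ?_⟩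
      change f (QuotientGroup.mk _) = QuotientGroup.mk k
      rw [hf, QuotientGroup.eq, Subgroup.mem_subgroupOf, Subgroup.coe_mul, Subgroup.coe_inv]
      have hk' : (k : G) = x⁻¹ * w⁻¹ * i⁻¹ := by
        rw [← inv_inv (k : G), hkx]; group
      rw [hk', show ((⟨(((⟨x, hxN⟩ : ↥N)⁻¹ : ↥N) : G) * w⁻¹, _⟩ : ↥K) : G) = x⁻¹ * w⁻¹ from rfl]
      rw [show (x⁻¹ * w⁻¹)⁻¹ * (x⁻¹ * w⁻¹ * i⁻¹) = i⁻¹ by group]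
      exact inv_mem hi

/-- **`[K : I] = [N ∩ K : N_𝔭] + 1`** under the rank-one Bruhat decomposition (both sides as `Subgroup.index`; `K ∕ I` finite).
[cite: CartierCorvallis1979, §III.5] [cite: Serre1980Trees, II §1.1] -/
theorem index_iwahori_subgroupOf_eq {w : G} (hw : w ∈ K)
    (hBr : ∀ k ∈ K, k ∉ I → ∃ i ∈ I, ∃ x ∈ N, x ∈ K ∧ k = i * w * x) (hdisj : ∀ x ∈ N, x ∈ K → w * x ∉ I)
    [Finite (↥K ⧸ I.subgroupOf K)] :
    (I.subgroupOf K).index = ((I.comap ((MulAut.conj w).toMonoidHom.comp N.subtype)).subgroupOf (K.subgroupOf N)).index + 1 := by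
  obtain ⟨e⟩ := exists_equiv_option_quotient_iwahori (N := N) hw hBr hdisj
  haveI : Finite (↥(K.subgroupOf N) ⧸ (I.comap ((MulAut.conj w).toMonoidHom.comp N.subtype)).subgroupOf (K.subgroupOf N)) :=
    Finite.of_injective (fun q => e (some q)) fun a b h => Option.some_injective _ (e.injective h)
  rw [Subgroup.index_eq_card, Subgroup.index_eq_card, ← Nat.card_congr e, Finite.card_option]

end Index

/-! ## §3 The `K`-averaged constant term of the Iwahori unit -/

section Average

variable {G : Type*} [Group G] [TopologicalSpace G] [IsTopologicalGroup G] {K I T N : Subgroup G}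

/-- **THE IWAHORI UNIT AVERAGED OVER `K` AT A TORUS ELEMENT.**  In rank-one Iwahori position ((gp), (bo), (br) of the module docstring), for
`t ∈ T`, a finite left-invariant Borel measure `κ` on `K` and a left-invariant `μ_N` on the abelian `N`:
`∫⁻_{K × N} 1_I(k (t n) k⁻¹) d(κ ⊗ μ_N) = 2 · κ(I) · μ_N(N ∩ K) · 1_K(t)`.  Proof: Tonelli in `k`; on `k ∈ I` the fibre is `N ∩ K`, on `k ∈ K ∖ I = I w (N ∩ K)`
it is a translate of `N_𝔭` (§1); `κ(K ∖ I) = [N ∩ K : N_𝔭] · κ(I)` by §2 and Mathlib `Subgroup.index_mul_measure`, and `[N ∩ K : N_𝔭] · μ_N(N_𝔭) = μ_N(N ∩ K)`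
(★ `measure_subgroup_eq_relIndex_mul`).  The measurability of the integrand is a binder (discharged by continuity on locally compact
instances). [cite: Kottwitz1988, §2 Theorem 2] [cite: Rogawski1990, §4.9 (4.9.2) p. 55; §12.6 p. 174] [cite: CartierCorvallis1979, §IV (4.2)] -/
theorem lintegral_prod_indicator_iwahori_conj_torus_mul_unipotent [MeasurableSpace G] [BorelSpace G]
    (κ : Measure ↥K) [IsFiniteMeasure κ] [κ.IsMulLeftInvariant] (μN : Measure ↥N) [SFinite μN] [μN.IsMulLeftInvariant]
    (hIK : I ≤ K) (hIo : IsOpen (I : Set G)) (hKc : IsCompact (K : Set G)) (hKm : MeasurableSet (K : Set G))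
    {w : G} (hw : w ∈ K) (hTI : ∀ t ∈ T, t ∈ K → t ∈ I) (hNI : ∀ n ∈ N, n ∈ K → n ∈ I)
    (hKP : ∀ ⦃t n : G⦄, t ∈ T → n ∈ N → t * n ∈ K → t ∈ K)
    (hTN : ∀ t ∈ T, ∀ n ∈ N, t⁻¹ * n * t ∈ N) (hNc : ∀ a ∈ N, ∀ b ∈ N, a * b = b * a)
    (hwT : ∀ t ∈ T, t ∈ K → w * t * w⁻¹ ∈ I)
    (hBr : ∀ k ∈ K, k ∉ I → ∃ i ∈ I, ∃ x ∈ N, x ∈ K ∧ k = i * w * x) (hdisj : ∀ x ∈ N, x ∈ K → w * x ∉ I)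
    {t : G} (ht : t ∈ T)
    (hF : Measurable fun p : ↥K × ↥N => (I : Set G).indicator (1 : G → ℝ≥0∞) ((p.1 : G) * (t * (p.2 : G)) * (p.1 : G)⁻¹)) :
    ∫⁻ p : ↥K × ↥N, (I : Set G).indicator (1 : G → ℝ≥0∞) ((p.1 : G) * (t * (p.2 : G)) * (p.1 : G)⁻¹) ∂(κ.prod μN) =
      2 * κ {k | (k : G) ∈ I} * μN {n | (n : G) ∈ K} * (K : Set G).indicator 1 t := by
  haveI : BorelSpace ↥K := Subtype.borelSpace _
  haveI : BorelSpace ↥N := Subtype.borelSpace _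
  -- the subgroups `I_K ≤ K`, `N_𝔭 ≤ N_K ≤ N` and their measurability
  set P : Subgroup ↥N := I.comap ((MulAut.conj w).toMonoidHom.comp N.subtype) with hPdef
  have hmemP : ∀ m : ↥N, m ∈ P ↔ w * (m : G) * w⁻¹ ∈ I := fun m => by
    rw [hPdef, Subgroup.mem_comap, MonoidHom.coe_comp, Function.comp_apply, Subgroup.coe_subtype, MulEquiv.coe_toMonoidHom,
      MulAut.conj_apply]
  have hPle : P ≤ K.subgroupOf N := fun m hm => Subgroup.mem_subgroupOf.2
    ((Subgroup.mul_mem_cancel_left K hw).1 ((Subgroup.mul_mem_cancel_right K (inv_mem hw)).1 (hIK ((hmemP m).1 hm))))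
  have hIKset : ((I.subgroupOf K : Subgroup ↥K) : Set ↥K) = {k : ↥K | (k : G) ∈ I} := rfl
  have hNKset : ((K.subgroupOf N : Subgroup ↥N) : Set ↥N) = {n : ↥N | (n : G) ∈ K} := rfl
  have hIKm : MeasurableSet {k : ↥K | (k : G) ∈ I} := (hIo.preimage continuous_subtype_val).measurableSet
  have hNKm : MeasurableSet {n : ↥N | (n : G) ∈ K} := measurable_subtype_coe hKm
  have hconj : Continuous fun m : ↥N => w * (m : G) * w⁻¹ := (continuous_const.mul continuous_subtype_val).mul continuous_const
  have hPo : IsOpen (P : Set ↥N) := by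
    have : (P : Set ↥N) = (fun m : ↥N => w * (m : G) * w⁻¹) ⁻¹' (I : Set G) := Set.ext fun m => hmemP m
    rw [this]; exact hIo.preimage hconj
  have hPm : MeasurableSet (P : Set ↥N) := hPo.measurableSet
  -- the case `t ∉ K`: the integrand vanishes
  by_cases htK : t ∈ K
  swap
  · have h0 : (fun p : ↥K × ↥N => (I : Set G).indicator (1 : G → ℝ≥0∞) ((p.1 : G) * (t * (p.2 : G)) * (p.1 : G)⁻¹)) = fun _ => 0 :=
      funext fun p => Set.indicator_of_notMem (conj_mul_notMem_iwahori_of_notMem hIK hKP p.1.2 ht p.2.2 htK) _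
    rw [h0, lintegral_zero, Set.indicator_of_notMem (show t ∉ (K : Set G) from htK), mul_zero]
  have htI : t ∈ I := hTI t ht htK
  rw [Set.indicator_of_mem (show t ∈ (K : Set G) from htK), Pi.one_apply, mul_one, lintegral_prod _ hF.aemeasurable]
  -- the inner integral, fibrewise (§1)
  have hinner : ∀ k : ↥K, ∫⁻ n : ↥N, (I : Set G).indicator (1 : G → ℝ≥0∞) ((k : G) * (t * (n : G)) * (k : G)⁻¹) ∂μN =
      {k : ↥K | (k : G) ∈ I}.indicator (fun _ => μN {n : ↥N | (n : G) ∈ K}) k + {k : ↥K | (k : G) ∈ I}ᶜ.indicator (fun _ => μN P) k := by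
    intro k
    have hind : (fun n : ↥N => (I : Set G).indicator (1 : G → ℝ≥0∞) ((k : G) * (t * (n : G)) * (k : G)⁻¹)) =
        {n : ↥N | (k : G) * (t * (n : G)) * (k : G)⁻¹ ∈ I}.indicator 1 := by
      funext n
      by_cases h : (k : G) * (t * (n : G)) * (k : G)⁻¹ ∈ I
      · rw [Set.indicator_of_mem (show (k : G) * (t * (n : G)) * (k : G)⁻¹ ∈ (I : Set G) from h),
          Set.indicator_of_mem (show n ∈ {m : ↥N | (k : G) * (t * (m : G)) * (k : G)⁻¹ ∈ I} from h)]
        rfl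
      · rw [Set.indicator_of_notMem (show (k : G) * (t * (n : G)) * (k : G)⁻¹ ∉ (I : Set G) from h),
          Set.indicator_of_notMem (show n ∉ {m : ↥N | (k : G) * (t * (m : G)) * (k : G)⁻¹ ∈ I} from h)]
    rw [hind]
    by_cases hk : (k : G) ∈ I
    · rw [setOf_conj_mul_coe_mem_iwahori_eq_of_mem hIK hNI hk htI, lintegral_indicator_one hNKm,
        Set.indicator_of_mem (show k ∈ {k : ↥K | (k : G) ∈ I} from hk), Set.indicator_of_notMem (show k ∉ {k : ↥K | (k : G) ∈ I}ᶜ from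
          fun h => h hk), add_zero]
    · obtain ⟨i, hi, x, hxN, -, hkx⟩ := hBr _ k.2 hk
      have hset : {n : ↥N | (k : G) * (t * (n : G)) * (k : G)⁻¹ ∈ I} =
          (fun n : ↥N => (⟨t⁻¹ * x * t * x⁻¹, mul_mem (hTN t ht x hxN) (inv_mem hxN)⟩ : ↥N) * n) ⁻¹' (P : Set ↥N) := by
        rw [hkx]; exact setOf_conj_mul_coe_mem_iwahori_eq_preimage_of_eq hTN hNc hi hxN ht (hwT t ht htK)
      rw [hset, lintegral_indicator_one (hPm.preimage (measurable_const_mul _)), measure_preimage_mul,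
        Set.indicator_of_notMem (show k ∉ {k : ↥K | (k : G) ∈ I} from hk),
        Set.indicator_of_mem (show k ∈ {k : ↥K | (k : G) ∈ I}ᶜ from hk), zero_add]
  simp_rw [hinner]
  rw [lintegral_add_left (measurable_const.indicator hIKm), lintegral_indicator_const hIKm, lintegral_indicator_const hIKm.compl]
  -- the measure identity `κ(K ∖ I) · μ_N(N_𝔭) = κ(I) · μ_N(N ∩ K)` (§2 + index × measure)
  haveI : CompactSpace ↥K := isCompact_iff_compactSpace.1 hKc
  haveI : Finite (↥K ⧸ I.subgroupOf K) := Subgroup.quotient_finite_of_isOpen _ (hIo.preimage continuous_subtype_val)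
  haveI : (I.subgroupOf K).FiniteIndex := Subgroup.finiteIndex_of_finite_quotient
  have hidx := index_iwahori_subgroupOf_eq (N := N) hw hBr hdisj
  have hK1 := (I.subgroupOf K).index_mul_measure hIKm κ
  rw [← measure_add_measure_compl hIKm, hIKset, hidx, Nat.cast_add, Nat.cast_one, add_mul, one_mul, add_comm] at hK1
  have hfin : κ {k : ↥K | (k : G) ∈ I} ≠ ∞ := measure_ne_top κ _
  have hC : κ {k : ↥K | (k : G) ∈ I}ᶜ =
      (((I.comap ((MulAut.conj w).toMonoidHom.comp N.subtype)).subgroupOf (K.subgroupOf N)).index : ℝ≥0∞) * κ {k : ↥K | (k : G) ∈ I} :=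
    (ENNReal.add_right_inj hfin).1 hK1.symm
  have hrel : ((I.comap ((MulAut.conj w).toMonoidHom.comp N.subtype)).subgroupOf (K.subgroupOf N)).index =
      P.relIndex (K.subgroupOf N) := rfl
  have hfinP : P.relIndex (K.subgroupOf N) ≠ 0 := by
    rw [← hrel]
    intro h0
    rw [h0, zero_add] at hidx
    -- `[K : I] = 1` would put `w ∈ K` inside `I`, contradicting `w · 1 ∉ I`
    have hwI : (⟨w, hw⟩ : ↥K) ∈ I.subgroupOf K := by rw [Subgroup.index_eq_one.1 hidx]; exact Subgroup.mem_top _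
    exact hdisj 1 (one_mem N) (one_mem K) (by rw [mul_one]; exact Subgroup.mem_subgroupOf.1 hwI)
  have hN1 : μN {n : ↥N | (n : G) ∈ K} = (P.relIndex (K.subgroupOf N) : ℝ≥0∞) * μN P := by
    rw [← hNKset]
    exact Literature.MeasureTheory.Group.measure_subgroup_eq_relIndex_mul μN hPle (hNKset ▸ hNKm) hPm hfinP
  rw [hC, hrel, hN1]
  ring

end Average

end Literature.NumberTheory.Automorphic

end
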